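import Summits.AtomisticToContinuum.HydrodynamicLimit.Theorems.CollisionIsometryCLTCollisionalTransferLocalityDefsE
import Literature.MathematicalPhysics.KineticTheory.EvenCollisionTubeFunctional
import HarnessLib

/-!
# [TS0]: the equilibrium rung of the two-scale statement [TS] — pure bookkeeping
(line `hemisphere-affine-slaving`, crux `CollisionalTransferLocality`, stmt-AtomisticToContinuum-9518)

Helper file (`--supports stmt-AtomisticToContinuum-9518`; registered stub `stub_twoScaleValueA_rung0`) of the
line lead.  At global equilibrium (constant profiles `a₀ = 1`, `u₀ = 0`, `θ₀ = θ`) the two-scale comparison of the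
value functionals `RhsA + KfunA` read at the macroscale cone kernel `b_r` (`coneKernel r · 0`) and at an admissible
mesoscale kernel `φ_N` is a consequence of FOUR convergence statements, all taken as hypotheses here (they are the
neighbouring stubs of the skeleton): for both kernels, `RhsA(τ) → L := θ (Z(σ³) − 1) ∫₀^τ∫ tr A` and `KfunA(τ) → 0`
in local-Gibbs probability.  The proof is the triangle inequality
`|(R_c + K_c) − (R_φ + K_φ)| ≤ |R_c − L| + |K_c| + |R_φ − L| + |K_φ|`, a union bound over the four deviation
events at accuracy `η/4`, and `Tendsto … (𝓝 0)` ⇒ eventually `≤ δ/4` for each of them.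
No mathematics beyond Mathlib's filter / measure API is used. [folklore]
-/

namespace Summit.AtomisticToContinuum.HydrodynamicLimit.Theorems.HemisphereAffineSlaving

open scoped BigOperators Topology Classical ENNReal InnerProductSpace
open Filter Set Function MeasureTheory

noncomputable section

open Literature.MathematicalPhysics.KineticTheory (T3 V3)

/-- Four-term triangle inequality behind the union bound: if each of `|a − L|`, `|b|`, `|c − L|`, `|d|` is at most
`η/4` then `|(a + b) − (c + d)| ≤ η`; stated contrapositively as a membership in the union of the four deviation
events. [folklore] -/
theorem abs_quad_split {a b c d L η : ℝ} (h : η < |(a + b) - (c + d)|) :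
    (η / 4 < |a - L| ∨ η / 4 < |b|) ∨ (η / 4 < |c - L| ∨ η / 4 < |d|) := by
  by_contra hcon
  simp only [not_or, not_lt] at hcon
  obtain ⟨⟨h1, h2⟩, h3, h4⟩ := hcon
  have e : (a + b) - (c + d) = ((a - L) + b) - ((c - L) + d) := by ring
  have key : |(a + b) - (c + d)| ≤ η := by
    rw [e]
    calc |((a - L) + b) - ((c - L) + d)| ≤ |(a - L) + b| + |(c - L) + d| := abs_sub _ _
      _ ≤ (|a - L| + |b|) + (|c - L| + |d|) := add_le_add (abs_add_le _ _) (abs_add_le _ _)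
      _ ≤ (η / 4 + η / 4) + (η / 4 + η / 4) := by gcongr
      _ = η := by ring
  exact absurd (lt_of_lt_of_le h key) (lt_irrefl _)

/-- The union bound at one `N`: the deviation event of `(f + g) − (f' + g')` at accuracy `η` is covered by the four
deviation events of `f − L`, `g`, `f' − L`, `g'` at accuracy `η/4`, hence its measure is at most the sum of theirs.
[folklore] -/
theorem measure_setOf_quad_le {α : Type*} [MeasurableSpace α] (μ : Measure α) (f g f' g' : α → ℝ) (L η : ℝ) :
    μ {z | η < |(f z + g z) - (f' z + g' z)|} ≤
      (μ {z | η / 4 < |f z - L|} + μ {z | η / 4 < |g z|}) +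
        (μ {z | η / 4 < |f' z - L|} + μ {z | η / 4 < |g' z|}) := by
  refine (measure_mono ?_).trans
    ((measure_union_le _ _).trans (add_le_add (measure_union_le _ _) (measure_union_le _ _)))
  intro z hz
  simp only [Set.mem_union, Set.mem_setOf_eq] at hz ⊢
  exact abs_quad_split hz

/-- `Tendsto u atTop (𝓝 0)` in `ℝ≥0∞` and `0 < δ` give: eventually `u N ≤ ENNReal.ofReal δ`. [folklore] -/
theorem eventually_le_ofReal_of_tendsto_zero {u : ℕ → ℝ≥0∞} (h : Tendsto u atTop (𝓝 0)) {δ : ℝ}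
    (hδ : 0 < δ) : ∀ᶠ N in atTop, u N ≤ ENNReal.ofReal δ := by
  have hδ' : (0 : ℝ≥0∞) < ENNReal.ofReal δ := ENNReal.ofReal_pos.2 hδ
  exact ((tendsto_order.1 h).2 _ hδ').mono fun _ hN => hN.le

/-- Four quarters make a whole inside `ENNReal.ofReal` (for `0 ≤ δ`). [folklore] -/
theorem ofReal_quarter_add_four {δ : ℝ} (hδ : 0 ≤ δ) :
    (ENNReal.ofReal (δ / 4) + ENNReal.ofReal (δ / 4)) + (ENNReal.ofReal (δ / 4) + ENNReal.ofReal (δ / 4)) =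
      ENNReal.ofReal δ := by
  have h4 : 0 ≤ δ / 4 := by positivity
  rw [← ENNReal.ofReal_add h4 h4, ← ENNReal.ofReal_add (by positivity) (by positivity)]
  congr 1
  ring

/-- **[TS0] — the equilibrium rung of the two-scale statement [TS].** From the four equilibrium convergence
statements (H1) `RhsA[φ_N](τ) → L`, (H2) `KfunA[φ_N](τ) → 0`, (H3) `RhsA[b_r](τ) → L`, (H4) `KfunA[b_r](τ) → 0` in
local-Gibbs probability (`L = θ (Z(σ³) − 1) ∫₀^τ∫ tr A`), the two-scale comparison
`P(η < |(RhsA + KfunA)[b_r](τ) − (RhsA + KfunA)[φ_N](τ)|) ≤ δ` for `N ≥ N₀(r)`, every `r < r₀ := 1/4`, with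
`σ₀ := min (min σ₁ σ₂) (min σ₃ σ₄)` and `η₁ := 1` (the dilution hypothesis is not used at equilibrium).
Triangle inequality + union bound + `Tendsto ⇒ ∃ N₀`. [folklore] -/
theorem stub_twoScaleValueA_rung0 : (∀ θ : ℝ, 0 < θ → ∃ σ₀ : ℝ, 0 < σ₀ ∧ ∀ σ : ℝ, 0 < σ → σ < σ₀ → ∀ (Φ : Flows σ) (t : ℝ), 0 < t → ∀ (γ C : ℝ) (φ : ℕ → T3 → ℝ), 0 < γ → γ ≤ 1 / 15 → AdmissibleKernel γ C φ → ∀ (A : ℝ → T3 → Fin 3 → Fin 3 → ℝ), SmoothMatrixOn (Icc 0 t) A → ∀ τ ∈ Icc 0 t, ∀ δ : ℝ, 0 < δ → Tendsto (fun N : ℕ => Literature.MathematicalPhysics.KineticTheory.localGibbsLaw σ (fun _ => 1) (fun _ => 0) (fun _ => θ) N (Φ N) {z | δ < |RhsA σ Φ φ A N z τ - θ * (Literature.MathematicalPhysics.KineticTheory.hsCompressibility (σ ^ 3) - 1) * ∫ s in Icc 0 τ, ∫ x, trW A s x|}) atTop (𝓝 0)) → (∀ θ : ℝ, 0 < θ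 → ∃ σ₀ : ℝ, 0 < σ₀ ∧ ∀ σ : ℝ, 0 < σ → σ < σ₀ → ∀ (Φ : Flows σ) (t : ℝ), 0 < t → ∀ (γ C : ℝ) (φ : ℕ → T3 → ℝ), 0 < γ → γ ≤ 1 / 15 → AdmissibleKernel γ C φ → ∀ (A : ℝ → T3 → Fin 3 → Fin 3 → ℝ), SmoothMatrixOn (Icc 0 t) A → ∀ τ ∈ Icc 0 t, ∀ δ : ℝ, 0 < δ → Tendsto (fun N : ℕ => Literature.MathematicalPhysics.KineticTheory.localGibbsLaw σ (fun _ => 1) (fun _ => 0) (fun _ => θ) N (Φ N) {z | δ < |KfunA σ Φ φ A N z τ|}) atTop (𝓝 0)) → (∀ θ : ℝ, 0 < θ → ∃ σ₀ : ℝ, 0 < σ₀ ∧ ∀ σ : ℝ, 0 < σ → σ < σ₀ → ∀ (Φ : Flows σ) (t : ℝ), 0 < t → ∀ (r : ℝ), 0 < r → r < 1 / 4 → ∀ (A : ℝ → T3 → Fin 3 → Fin 3 → ℝ), SmoothMatrixOn (Icc 0 t) A → ∀ τ ∈ Icc 0 t, ∀ δ : ℝ, 0 < δ → Tendsto (fun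 N : ℕ => Literature.MathematicalPhysics.KineticTheory.localGibbsLaw σ (fun _ => 1) (fun _ => 0) (fun _ => θ) N (Φ N) {z | δ < |RhsA σ Φ (fun (_ : ℕ) (y : T3) => Literature.MathematicalPhysics.KineticTheory.coneKernel r y 0) A N z τ - θ * (Literature.MathematicalPhysics.KineticTheory.hsCompressibility (σ ^ 3) - 1) * ∫ s in Icc 0 τ, ∫ x, trW A s x|}) atTop (𝓝 0)) → (∀ θ : ℝ, 0 < θ → ∃ σ₀ : ℝ, 0 < σ₀ ∧ ∀ σ : ℝ, 0 < σ → σ < σ₀ → ∀ (Φ : Flows σ) (t : ℝ), 0 < t → ∀ (r : ℝ), 0 < r → r < 1 / 4 → ∀ (A : ℝ → T3 → Fin 3 → Fin 3 → ℝ), SmoothMatrixOn (Icc 0 t) A → ∀ τ ∈ Icc 0 t, ∀ δ : ℝ, 0 < δ → Tendsto (fun N : ℕ => Literature.MathematicalPhysics.KineticTheory.localGibbsLaw σ (fun _ => 1) (fun _ => 0) (fun _ => θ) N (Φ N) {z | δ < |KfunA σ Φ (fun (_ : ℕ) (y : T3) => Literature.MathematicalPhysics.KineticTheory.coneKernel r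 y 0) A N z τ|}) atTop (𝓝 0)) → ∀ θ : ℝ, 0 < θ → ∃ σ₀ : ℝ, 0 < σ₀ ∧ ∃ η₁ : ℝ, 0 < η₁ ∧ ∀ σ : ℝ, 0 < σ → σ < σ₀ → ∀ (Φ : Flows σ) (t : ℝ), 0 < t → ∀ (γ C : ℝ) (φ : ℕ → T3 → ℝ), 0 < γ → γ ≤ 1 / 15 → AdmissibleKernel γ C φ → DiluteAt σ (fun _ => 1) (fun _ => θ) (fun _ => 0) Φ t φ η₁ → ∀ (A : ℝ → T3 → Fin 3 → Fin 3 → ℝ), SmoothMatrixOn (Icc 0 t) A → ∀ τ ∈ Icc 0 t, ∀ η δ : ℝ, 0 < η → 0 < δ → ∃ r₀ : ℝ, 0 < r₀ ∧ ∀ r : ℝ, 0 < r → r < r₀ → ∃ N₀ : ℕ, ∀ N : ℕ, N₀ ≤ N → Literature.MathematicalPhysics.KineticTheory.localGibbsLaw σ (fun _ => 1) (fun _ => 0) (fun _ => θ) N (Φ N) {z | η < |(RhsA σ Φ (fun (_ : ℕ) (y : T3) => Literature.MathematicalPhysics.KineticTheory.coneKernel r y 0) A N z τ + KfunA σ Φ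 (fun (_ : ℕ) (y : T3) => Literature.MathematicalPhysics.KineticTheory.coneKernel r y 0) A N z τ) - (RhsA σ Φ φ A N z τ + KfunA σ Φ φ A N z τ)|} ≤ ENNReal.ofReal δ := by
  intro H1 H2 H3 H4 θ hθ
  obtain ⟨σ₁, hσ₁, H1'⟩ := H1 θ hθ
  obtain ⟨σ₂, hσ₂, H2'⟩ := H2 θ hθ
  obtain ⟨σ₃, hσ₃, H3'⟩ := H3 θ hθ
  obtain ⟨σ₄, hσ₄, H4'⟩ := H4 θ hθ
  refine ⟨min (min σ₁ σ₂) (min σ₃ σ₄), lt_min (lt_min hσ₁ hσ₂) (lt_min hσ₃ hσ₄), 1, one_pos, ?_⟩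
  intro σ hσ hlt Φ t ht γ C φ hγ hγ' hadm _hDil A hA τ hτ η δ hη hδ
  have hσ1 : σ < σ₁ := lt_of_lt_of_le hlt ((min_le_left _ _).trans (min_le_left _ _))
  have hσ2 : σ < σ₂ := lt_of_lt_of_le hlt ((min_le_left _ _).trans (min_le_right _ _))
  have hσ3 : σ < σ₃ := lt_of_lt_of_le hlt ((min_le_right _ _).trans (min_le_left _ _))
  have hσ4 : σ < σ₄ := lt_of_lt_of_le hlt ((min_le_right _ _).trans (min_le_right _ _))
  refine ⟨1 / 4, by norm_num, ?_⟩
  intro r hr hrlt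
  have hη4 : 0 < η / 4 := by positivity
  have hδ4 : 0 < δ / 4 := by positivity
  have e1 := eventually_le_ofReal_of_tendsto_zero
    (H1' σ hσ hσ1 Φ t ht γ C φ hγ hγ' hadm A hA τ hτ (η / 4) hη4) hδ4
  have e2 := eventually_le_ofReal_of_tendsto_zero
    (H2' σ hσ hσ2 Φ t ht γ C φ hγ hγ' hadm A hA τ hτ (η / 4) hη4) hδ4
  have e3 := eventually_le_ofReal_of_tendsto_zero
    (H3' σ hσ hσ3 Φ t ht r hr hrlt A hA τ hτ (η / 4) hη4) hδ4
  have e4 := eventually_le_ofReal_of_tendsto_zero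
    (H4' σ hσ hσ4 Φ t ht r hr hrlt A hA τ hτ (η / 4) hη4) hδ4
  obtain ⟨N₀, hN₀⟩ := eventually_atTop.1 ((e3.and e4).and (e1.and e2))
  refine ⟨N₀, fun N hN => ?_⟩
  obtain ⟨⟨b3, b4⟩, b1, b2⟩ := hN₀ N hN
  refine (measure_setOf_quad_le _ _ _ _ _
    (θ * (Literature.MathematicalPhysics.KineticTheory.hsCompressibility (σ ^ 3) - 1) *
      ∫ s in Icc 0 τ, ∫ x, trW A s x) η).trans ?_
  calc _ ≤ (ENNReal.ofReal (δ / 4) + ENNReal.ofReal (δ / 4)) +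
        (ENNReal.ofReal (δ / 4) + ENNReal.ofReal (δ / 4)) :=
        add_le_add (add_le_add b3 b4) (add_le_add b1 b2)
    _ = ENNReal.ofReal δ := ofReal_quarter_add_four hδ.le

end

end Summit.AtomisticToContinuum.HydrodynamicLimit.Theorems.HemisphereAffineSlaving
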